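import Literature.Topology.FourManifolds.OrientationSign
import Mathlib

/-!
# A local diffeomorphism of a connected domain has constant orientation character
(registered helper `helper_posFrameOfLocalDiffeoConst` of the stub `stub_normalWitnessTransfer`,
line `cross-cap-laurent`, crux `GromovRecognitionRelEnd`, item stmt-SmoothPoincare4-11009)

Setting: `o` is a smooth orientation of the `4`-manifold `M`
(`Literature.Topology.FourManifolds.SmoothOrientation`), `Φ : ℂ × ℂ → M` is smooth on the open
preconnected set `O ⊆ ℂ²` with injective (hence bijective) differential at every point of `O`.
Claim: the orientation character (`SmoothOrientation.IsPosFrame`) of the image frame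
`dΦ_q(1,0), dΦ_q(i,0), dΦ_q(0,1), dΦ_q(0,i)` of `T_{Φ q} M` is the same at all points `q ∈ O`
("a local diffeomorphism of a connected domain preserves or reverses orientation everywhere",
M. W. Hirsch, *Differential Topology*, GTM 33 (1976), Ch. 4 §4).

Proof: the constancy principle
`Literature.Topology.FourManifolds.SmoothOrientation.isPosFrame_iff_of_isPreconnected` for the
moving frame `B q = dΦ_q ∘ v` (`v` a fixed real basis of `ℂ²`) along `γ = Φ` on `S = O`.  Its
inputs: `Φ` is continuous on `O`; the frame is nowhere degenerate since `dΦ_q` is injective and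
`v` is linearly independent; and for every `p : M` the reading of the frame in the chart at `p`,
`tangentCoordChange (Φ q) p (Φ q) ∘ dΦ_q = D(φ_p ∘ Φ)(q)` (chain rule,
`mfderiv (chartAt p) = tangentCoordChange`), is the honest derivative of the smooth map
`φ_p ∘ Φ : ℂ² → ℝ⁴` on the open set `O ∩ Φ⁻¹(dom φ_p)`, hence continuous there.  Finally
`(1,0), (i,0), (0,1), (0,i)` is linearly independent over `ℝ`.
No new definitions.
-/

noncomputable section

open scoped Manifold ContDiff Topology
open Set Module Function Filter Literature.Topology.FourManifolds

-- the prescribed namespace `Summit.<P>.<Sub>.…` duplicates `SmoothPoincare4` (P = Sub)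
set_option linter.dupNamespace false

namespace Summit.SmoothPoincare4.SmoothPoincare4.Theorems.GromovRecognitionRelEnd.CrossCapLaurent

namespace HelperPosFrameOfLocalDiffeoConst

/-- The four vectors `(1,0), (i,0), (0,1), (0,i)` of `ℂ²` are linearly independent over `ℝ`
(they form the standard real basis of `ℂ² ≅ ℝ⁴`). [folklore] -/
theorem linearIndependent_stdFrame :
    LinearIndependent ℝ
      (![((1 : ℂ), (0 : ℂ)), (Complex.I, 0), (0, 1), (0, Complex.I)] : Fin 4 → ℂ × ℂ) := by
  rw [Fintype.linearIndependent_iff]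
  intro g hg i
  simp only [Fin.sum_univ_four, Matrix.cons_val_zero, Matrix.cons_val_one, Matrix.cons_val,
    Prod.smul_mk, Prod.mk_add_mk, Prod.mk_eq_zero, smul_zero, add_zero, zero_add,
    Complex.ext_iff, Complex.add_re, Complex.add_im, Complex.real_smul, Complex.mul_re,
    Complex.mul_im, Complex.ofReal_re, Complex.ofReal_im, Complex.one_re, Complex.one_im,
    Complex.I_re, Complex.I_im, Complex.zero_re, Complex.zero_im] at hg
  fin_cases i <;> simp_all

/-- **Chain rule in a fixed chart** for a map `Φ : ℂ × ℂ → M⁴` differentiable at `q` with `Φ q`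
in the domain of the chart at `p`: the reading of `dΦ_q w` in the chart at `p` is the honest
derivative `D(φ_p ∘ Φ)(q) w` of the chart representative. [folklore] -/
theorem tangentCoordChange_mfderiv_eq_fderiv {M : Type} [TopologicalSpace M]
    [ChartedSpace (EuclideanSpace ℝ (Fin 4)) M] [IsManifold (𝓡 4) ∞ M]
    {Φ : ℂ × ℂ → M} {q : ℂ × ℂ} {p : M}
    (hΦ : MDifferentiableAt 𝓘(ℝ, ℂ × ℂ) (𝓡 4) Φ q)
    (hq : Φ q ∈ (chartAt (EuclideanSpace ℝ (Fin 4)) p).source) (w : ℂ × ℂ) :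
    tangentCoordChange (𝓡 4) (Φ q) p (Φ q) (mfderiv 𝓘(ℝ, ℂ × ℂ) (𝓡 4) Φ q w) =
      fderiv ℝ (extChartAt (𝓡 4) p ∘ Φ) q w := by
  have h := (hasMFDerivAt_extChartAt (I := 𝓡 4) hq).comp q hΦ.hasMFDerivAt
  rw [← mfderiv_eq_fderiv, h.mfderiv, mfderiv_chartAt_eq_tangentCoordChange (I := 𝓡 4) hq]
  rfl

/-- **Constancy of the orientation character of `dΦ ∘ v`** for a fixed linearly independent
family `v` of `ℂ²` indexed by `Fin (finrank ℝ ℝ⁴)`: the principle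
`SmoothOrientation.isPosFrame_iff_of_isPreconnected` applied to the moving frame
`q ↦ (dΦ_q (v i))_i` along `Φ` on the open preconnected `O`
(Hirsch, *Differential Topology* (1976), Ch. 4 §4). [folklore] -/
theorem isPosFrame_mfderiv_iff_of_isPreconnected {M : Type} [TopologicalSpace M]
    [ChartedSpace (EuclideanSpace ℝ (Fin 4)) M] [IsManifold (𝓡 4) ∞ M]
    (o : SmoothOrientation (𝓡 4) M) {Φ : ℂ × ℂ → M} {O : Set (ℂ × ℂ)} (hO : IsOpen O)
    (hOc : IsPreconnected O) (hΦ : ContMDiffOn 𝓘(ℝ, ℂ × ℂ) (𝓡 4) ∞ Φ O)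
    (hinj : ∀ q ∈ O, Injective (mfderiv 𝓘(ℝ, ℂ × ℂ) (𝓡 4) Φ q))
    {v : Fin (finrank ℝ (EuclideanSpace ℝ (Fin 4))) → ℂ × ℂ} (hv : LinearIndependent ℝ v)
    {q q' : ℂ × ℂ} (hq : q ∈ O) (hq' : q' ∈ O) :
    o.IsPosFrame (Φ q) (fun i => mfderiv 𝓘(ℝ, ℂ × ℂ) (𝓡 4) Φ q (v i)) ↔
      o.IsPosFrame (Φ q') (fun i => mfderiv 𝓘(ℝ, ℂ × ℂ) (𝓡 4) Φ q' (v i)) := by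
  -- differentiability of `Φ` on the open set `O`
  have hmd : ∀ y ∈ O, MDifferentiableAt 𝓘(ℝ, ℂ × ℂ) (𝓡 4) Φ y := fun y hy =>
    (hΦ.contMDiffAt (hO.mem_nhds hy)).mdifferentiableAt (by simp)
  refine o.isPosFrame_iff_of_isPreconnected hOc
    (B := fun y i => mfderiv 𝓘(ℝ, ℂ × ℂ) (𝓡 4) Φ y (v i)) hΦ.continuousOn ?_ ?_ hq hq'
  · -- (hB) the chart readings of the frame are continuous
    intro p
    have hS'o : IsOpen (O ∩ Φ ⁻¹' (chartAt (EuclideanSpace ℝ (Fin 4)) p).source) :=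
      hΦ.continuousOn.isOpen_inter_preimage hO (chartAt (EuclideanSpace ℝ (Fin 4)) p).open_source
    -- the chart representative `φ_p ∘ Φ` is smooth there, hence `C¹` with continuous derivative
    have hF : ContMDiffOn 𝓘(ℝ, ℂ × ℂ) 𝓘(ℝ, EuclideanSpace ℝ (Fin 4)) ∞
        (extChartAt (𝓡 4) p ∘ Φ) (O ∩ Φ ⁻¹' (chartAt (EuclideanSpace ℝ (Fin 4)) p).source) :=
      (contMDiffOn_extChartAt (I := 𝓡 4) (n := ∞) (x := p)).comp (hΦ.mono inter_subset_left)
        (fun y hy => hy.2)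
    have hDF : ContinuousOn (fderiv ℝ (extChartAt (𝓡 4) p ∘ Φ))
        (O ∩ Φ ⁻¹' (chartAt (EuclideanSpace ℝ (Fin 4)) p).source) :=
      (contMDiffOn_iff_contDiffOn.1 hF).continuousOn_fderiv_of_isOpen hS'o (by simp)
    have hcont : ContinuousOn (fun y (i : Fin (finrank ℝ (EuclideanSpace ℝ (Fin 4)))) =>
        fderiv ℝ (extChartAt (𝓡 4) p ∘ Φ) y (v i))
        (O ∩ Φ ⁻¹' (chartAt (EuclideanSpace ℝ (Fin 4)) p).source) :=
      continuousOn_pi.2 fun i => hDF.clm_apply continuousOn_const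
    refine hcont.congr fun y hy => ?_
    funext i
    exact tangentCoordChange_mfderiv_eq_fderiv (hmd y hy.1) hy.2 _
  · -- (hdet) the frame is nowhere degenerate
    intro y hy
    refine det_ne_zero_of_linearIndependent _ ?_
    have hker : LinearMap.ker (mfderiv 𝓘(ℝ, ℂ × ℂ) (𝓡 4) Φ y).toLinearMap = ⊥ :=
      LinearMap.ker_eq_bot.2 (hinj y hy)
    exact hv.map' _ hker

end HelperPosFrameOfLocalDiffeoConst

open HelperPosFrameOfLocalDiffeoConst in
/-- **A local diffeomorphism of a connected domain has constant orientation character**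
(Hirsch, *Differential Topology* (1976), Ch. 4 §4): for `Φ : ℂ² ⊇ O → M⁴` smooth with injective
differential on the open preconnected `O`, the image frame `dΦ_q(1,0), dΦ_q(i,0), dΦ_q(0,1),
dΦ_q(0,i)` is positively oriented for `o` either at every `q ∈ O` or at no `q ∈ O`. [folklore] -/
theorem helper_posFrameOfLocalDiffeoConst : ∀ (M : Type) [TopologicalSpace M] [ChartedSpace (EuclideanSpace ℝ (Fin 4)) M] [IsManifold (𝓡 4) ∞ M] (o : Literature.Topology.FourManifolds.SmoothOrientation (𝓡 4) M) (Φ : ℂ × ℂ → M) (O : Set (ℂ × ℂ)), IsOpen O → IsPreconnected O → ContMDiffOn 𝓘(ℝ, ℂ × ℂ) (𝓡 4) ∞ Φ O → (∀ q ∈ O, Function.Injective (mfderiv 𝓘(ℝ, ℂ × ℂ) (𝓡 4) Φ q)) → ∀ q ∈ O, ∀ q' ∈ O, (o.IsPosFrame (Φ q) (![mfderiv 𝓘(ℝ, ℂ × ℂ) (𝓡 4) Φ q (1, 0), mfderiv 𝓘(ℝ, ℂ × ℂ) (𝓡 4) Φ q (Complex.I, 0), mfderiv 𝓘(ℝ,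 ℂ × ℂ) (𝓡 4) Φ q (0, 1), mfderiv 𝓘(ℝ, ℂ × ℂ) (𝓡 4) Φ q (0, Complex.I)] ∘ ⇑(finCongr finrank_euclideanSpace_fin)) ↔ o.IsPosFrame (Φ q') (![mfderiv 𝓘(ℝ, ℂ × ℂ) (𝓡 4) Φ q' (1, 0), mfderiv 𝓘(ℝ, ℂ × ℂ) (𝓡 4) Φ q' (Complex.I, 0), mfderiv 𝓘(ℝ, ℂ × ℂ) (𝓡 4) Φ q' (0, 1), mfderiv 𝓘(ℝ, ℂ × ℂ) (𝓡 4) Φ q' (0, Complex.I)] ∘ ⇑(finCongr finrank_euclideanSpace_fin))) := by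
  intro M _ _ _ o Φ O hO hOc hΦ hinj q hq q' hq'
  -- the fixed real basis `(1,0), (i,0), (0,1), (0,i)` of `ℂ²`, reindexed by `Fin (finrank ℝ ℝ⁴)`
  have hv : LinearIndependent ℝ
      ((![((1 : ℂ), (0 : ℂ)), (Complex.I, 0), (0, 1), (0, Complex.I)] : Fin 4 → ℂ × ℂ) ∘
        ⇑(finCongr (finrank_euclideanSpace_fin (𝕜 := ℝ) (n := 4)))) :=
    (linearIndependent_equiv _).2 linearIndependent_stdFrame
  have h := isPosFrame_mfderiv_iff_of_isPreconnected o hO hOc hΦ hinj hv hq hq'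
  -- the frames in the statement are `dΦ ∘` this family
  have key : ∀ y : ℂ × ℂ,
      (![mfderiv 𝓘(ℝ, ℂ × ℂ) (𝓡 4) Φ y (1, 0), mfderiv 𝓘(ℝ, ℂ × ℂ) (𝓡 4) Φ y (Complex.I, 0),
          mfderiv 𝓘(ℝ, ℂ × ℂ) (𝓡 4) Φ y (0, 1), mfderiv 𝓘(ℝ, ℂ × ℂ) (𝓡 4) Φ y (0, Complex.I)] ∘
        ⇑(finCongr finrank_euclideanSpace_fin) :
        Fin (finrank ℝ (EuclideanSpace ℝ (Fin 4))) → EuclideanSpace ℝ (Fin 4)) =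
      fun i => mfderiv 𝓘(ℝ, ℂ × ℂ) (𝓡 4) Φ y
        (((![((1 : ℂ), (0 : ℂ)), (Complex.I, 0), (0, 1), (0, Complex.I)] : Fin 4 → ℂ × ℂ) ∘
          ⇑(finCongr (finrank_euclideanSpace_fin (𝕜 := ℝ) (n := 4)))) i) := by
    intro y
    funext i
    simp only [Function.comp_apply]
    generalize finCongr finrank_euclideanSpace_fin i = j
    fin_cases j <;> rfl
  rw [key q, key q']
  exact h

end Summit.SmoothPoincare4.SmoothPoincare4.Theorems.GromovRecognitionRelEnd.CrossCapLaurent
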